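import Summits.ResolutionOfSingularities.ResolutionOfSingularities.Theorems.FrobeniusClosingSteerLowTowerSigmaTopInputs
import Summits.ResolutionOfSingularities.ResolutionOfSingularities.Theorems.FrobeniusClosingSteerCriticalThreadStep
import Literature.AlgebraicGeometry.Resolution.RsopPartOfRegularSequence
import Literature.AlgebraicGeometry.Resolution.RegularSystemOfParameters
import HarnessLib

/-!
# Steer σ-residual, LOW half — D3a leaf inputs: σ_top SEMANTICS along the run (`hns ∧ hT9` for every stage)

OURS (campaign res-hironaka, rung L ★L-G4, slot W4.1, crux `Steer` stmt-ResolutionOfSingularities-16345; res-L0-w41-plan-1 RULING 112a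
second hand := res-L0-w41-stub-3 g6; replaces the role of no printed item; NOT a statement of the manuscript under review
[claim: Hironaka2017, status: under-review]; AI review is weaker than expert review). Theses-free, definition-free.

`sigmaTop_inputs_run`: along the LOW sub-run `R (i₀ + ·)` (members regular of dimension `4`, dominated by `O`; σ_top centre at each stage in
the tree words of `…SteerSigmaTopLegality`; local blowing up, exceptional parameter, strict step; every stage singular), given the thread
invariant `hinv` at every stage (res-type-096's `CriticalThread.criticalThread_run` over `CriticalThread.thread_step`), the two σ_top inputs
of res-D-pv-012's `LowTower.exists_lowTower` hold at every stage: `hns` (the torsor is regular at the critical prime) and, at POINT stages,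
`hT9` (image-quantified: no singular regular curve on the surface torsor of any surjective image with kernel the critical prime). Per stage:
`thread_step` gives the `Λ`-unit exceptional parameter in the centre, then `LowTowerInputs.isRegularLocalRing_torsor_at_trace` and
`…_image_of_pointStep`. [cite: Matsumura1987, Thm. 14.2] [folklore]
-/

noncomputable section

-- single-problem summit: the doubled namespace component `ResolutionOfSingularities` is forced
set_option linter.dupNamespace false

namespace Summit.ResolutionOfSingularities.ResolutionOfSingularities.Theorems.SwitchingDichotomy.LowTowerInputs

open IsLocalRing Polynomial
open Literature.AlgebraicGeometry.Resolution
open Summit.ResolutionOfSingularities.ResolutionOfSingularities.Theorems.SwitchingDichotomy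
open Summit.ResolutionOfSingularities.ResolutionOfSingularities.Theorems.SwitchingDichotomy.SigmaTopLegality

variable {K : Type} [Field K] [CharP K 2]

/-- The empty family is part of a regular system of parameters of any regular local ring. [folklore] -/
theorem isRsopPart_fin_zero' {S : Type} [CommRing S] [IsRegularLocalRing S] (z : Fin 0 → S) : IsRsopPart z := by
  obtain ⟨x, hx⟩ := exists_regularSystemOfParameters (R := S)
  refine ⟨inferInstance, (maximalIdeal S).spanFinrank, x, ?_, ?_⟩
  · rw [zero_add]; exact (IsRegularLocalRing.spanFinrank_maximalIdeal (R := S)).symm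
  · rw [Set.range_eq_empty z, Set.empty_union]; exact hx

/-- **At one stage: the exceptional parameter is a unit of `Λ`** — the first output of `CriticalThread.thread_step`, prepared from the
σ_top words (centre with regular quotient and `f ≡ g² (mod P²)` or the closed point), the thread invariant and the singularity of the next
stage; the nesting of `(δ₁ f, δ₂ f)` in the centre is `exists_isRsopPart_append_span_eq` (Matsumura 14.2). [cite: Matsumura1987, Thm. 14.2] -/
theorem isUnit_excParam_of_step {O : ValuationSubring K} {R R' Λ : Subring K} [IsRegularLocalRing R] [IsLocalRing R'] [IsLocalRing Λ]
    (hRO : SubringDominates R O.toSubring) (hle : R ≤ Λ)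
    {s s' G x : K} (hs : s ^ 2 ∈ R) (hs' : s' ^ 2 ∈ R') (δ₁ δ₂ : Derivation ℤ R R)
    (hI1 : ∀ r : R, r ∈ Ideal.span {δ₁ ⟨s ^ 2, hs⟩, δ₂ ⟨s ^ 2, hs⟩} ↔ ¬ IsUnit (⟨(r : K), hle r.2⟩ : Λ))
    (hI2 : IsRsopPart ![δ₁ ⟨s ^ 2, hs⟩, δ₂ ⟨s ^ 2, hs⟩])
    (hI3 : IsUnit (δ₁ (δ₁ ⟨s ^ 2, hs⟩) * δ₂ (δ₂ ⟨s ^ 2, hs⟩) - δ₁ (δ₂ ⟨s ^ 2, hs⟩) * δ₂ (δ₁ ⟨s ^ 2, hs⟩)))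
    {P : Ideal R}
    (hσ : IsPermissibleCentre R 2 ⟨s ^ 2, hs⟩ P ∨
      (P = maximalIdeal R ∧ (∀ Q : Ideal R, ¬ IsPermissibleCentre R 2 ⟨s ^ 2, hs⟩ Q) ∧
        ∃ g : R, (⟨s ^ 2, hs⟩ : R) - g ^ 2 ∈ maximalIdeal R ^ 2))
    (hbl : IsLocalBlowupAlong O R P R')
    (hxR : x ∈ R) (hxP : (⟨x, hxR⟩ : R) ∈ P) (hx0 : x ≠ 0)
    (hxmax : ∀ w : R, w ∈ P → O.valuation (w : K) ≤ O.valuation x)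
    (hG : G ∈ R) (hstep : s = x * s' + G)
    (hsing : ∃ γ : R', (⟨s' ^ 2, hs'⟩ : R') - γ ^ 2 ∈ maximalIdeal R' ^ 2) :
    IsUnit (⟨x, hle hxR⟩ : Λ) := by
  classical
  haveI : Fact (2 : ℕ).Prime := ⟨Nat.prime_two⟩
  haveI : CharP R 2 := inferInstance
  have hval : ∀ a : R, a ∈ maximalIdeal R ↔ O.valuation (a : K) < 1 :=
    (subringDominates_valuationSubring_iff hRO.1).mp hRO
  -- the centre: regular quotient, and `δ_j f ∈ P`
  have hPreg : IsRegularLocalRing (R ⧸ P) := by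
    rcases hσ with ⟨-, -, hq, -⟩ | ⟨hPt, -⟩
    · exact hq
    · rw [hPt]
      letI : Field (R ⧸ maximalIdeal R) := Ideal.Quotient.field _
      infer_instance
  haveI := hPreg
  have hePm : ∀ k, (![δ₁ ⟨s ^ 2, hs⟩, δ₂ ⟨s ^ 2, hs⟩] k) ∈ P := by
    have hmem : ∀ δ : Derivation ℤ R R, δ ⟨s ^ 2, hs⟩ ∈ maximalIdeal R → δ ⟨s ^ 2, hs⟩ ∈ P := by
      intro δ hm
      rcases hσ with ⟨-, -, -, g, hg⟩ | ⟨hPt, -⟩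
      · have h1 := CriticalSurface.derivation_apply_mem_of_mem_sq δ P hg
        rwa [map_sub, CriticalSurface.derivation_apply_sq, sub_zero] at h1
      · rw [hPt]; exact hm
    intro k
    fin_cases k
    · exact hmem δ₁ (hI2.mem_maximalIdeal 0)
    · exact hmem δ₂ (hI2.mem_maximalIdeal 1)
  obtain ⟨r, c, -, hfam, hspan⟩ := exists_isRsopPart_append_span_eq (J := P) (b := (Fin.elim0 : Fin 0 → R))
    hI2 hePm (fun k => Fin.elim0 k) (isRsopPart_fin_zero' _)
  have hy : IsRsopPart (Fin.append ![δ₁ ⟨s ^ 2, hs⟩, δ₂ ⟨s ^ 2, hs⟩] c) := hfam.append_left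
  have hy0 : (Fin.append ![δ₁ ⟨s ^ 2, hs⟩, δ₂ ⟨s ^ 2, hs⟩] c) (Fin.castAdd r 0) = δ₁ ⟨s ^ 2, hs⟩ := by
    rw [Fin.append_left]; rfl
  have hy1 : (Fin.append ![δ₁ ⟨s ^ 2, hs⟩, δ₂ ⟨s ^ 2, hs⟩] c) (Fin.castAdd r 1) = δ₂ ⟨s ^ 2, hs⟩ := by
    rw [Fin.append_left]; rfl
  exact (CriticalThread.thread_step hval hle hs hs' δ₁ δ₂ hI1 hI3 hy hspan hy0 hy1 hbl hxR hxP hx0 hxmax hG hstep hsing).1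

/-- **σ_top INPUTS ALONG THE RUN (`hns ∧ hT9`).** See the module docstring; the thread invariant `hinv` is res-D-pv-012's binder
VERBATIM (supplied by res-type-096's `CriticalThread.criticalThread_run`), the σ_top clause is in the tree words of
`…SteerSigmaTopLegality` (bodies VERBATIM the skeleton's). [cite: Matsumura1987, Thm. 14.2] -/
theorem sigmaTop_inputs_run
    (O : ValuationSubring K) (R : ℕ → Subring K) (P : (i : ℕ) → Ideal (R i)) (s : ℕ → K) (i₀ : ℕ)
    (hreg : ∀ n, IsRegularLocalRing (R (i₀ + n)))
    (hRO : ∀ n, SubringDominates (R (i₀ + n)) O.toSubring)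
    (hdim : ∀ n, ringKrullDim (R (i₀ + n)) = (4 : ℕ))
    (hs2 : ∀ n, s (i₀ + n) ^ 2 ∈ R (i₀ + n))
    (hσ : ∀ n (hl : IsLocalRing (R (i₀ + n))),
      IsPermissibleCentre (R (i₀ + n)) 2 ⟨s (i₀ + n) ^ 2, hs2 n⟩ (P (i₀ + n)) ∨
        (P (i₀ + n) = maximalIdeal (R (i₀ + n)) ∧
          (∀ Q : Ideal (R (i₀ + n)), ¬ IsPermissibleCentre (R (i₀ + n)) 2 ⟨s (i₀ + n) ^ 2, hs2 n⟩ Q) ∧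
          ∃ g : R (i₀ + n), (⟨s (i₀ + n) ^ 2, hs2 n⟩ : R (i₀ + n)) - g ^ 2 ∈ maximalIdeal (R (i₀ + n)) ^ 2))
    (hbl : ∀ n, IsLocalBlowupAlong O (R (i₀ + n)) (P (i₀ + n)) (R (i₀ + n + 1)))
    (hx : ∀ n, ∃ x G : K, (∃ hx : x ∈ R (i₀ + n), (⟨x, hx⟩ : R (i₀ + n)) ∈ P (i₀ + n)) ∧ x ≠ 0 ∧
      (∀ y : R (i₀ + n), y ∈ P (i₀ + n) → O.valuation (y : K) ≤ O.valuation x) ∧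
      G ∈ R (i₀ + n) ∧ s (i₀ + n) = x * s (i₀ + n + 1) + G)
    (hsing : ∀ n, ∃ γ : R (i₀ + n), (⟨s (i₀ + n) ^ 2, hs2 n⟩ : R (i₀ + n)) - γ ^ 2 ∈ maximalIdeal (R (i₀ + n)) ^ 2)
    (Λ : Subring K) [IsLocalRing Λ]
    (hinv : ∀ n : ℕ, ∃ (hle : R (i₀ + n) ≤ Λ) (_ : IsLocalRing (R (i₀ + n))) (hs : s (i₀ + n) ^ 2 ∈ R (i₀ + n))
      (δ₁ δ₂ : Derivation ℤ (R (i₀ + n)) (R (i₀ + n))),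
      (∀ r : R (i₀ + n), r ∈ Ideal.span {δ₁ ⟨s (i₀ + n) ^ 2, hs⟩, δ₂ ⟨s (i₀ + n) ^ 2, hs⟩} ↔
        ¬ IsUnit (⟨(r : K), hle r.2⟩ : Λ)) ∧
      IsRsopPart ![δ₁ ⟨s (i₀ + n) ^ 2, hs⟩, δ₂ ⟨s (i₀ + n) ^ 2, hs⟩] ∧
      IsUnit (δ₁ (δ₁ ⟨s (i₀ + n) ^ 2, hs⟩) * δ₂ (δ₂ ⟨s (i₀ + n) ^ 2, hs⟩) -
        δ₁ (δ₂ ⟨s (i₀ + n) ^ 2, hs⟩) * δ₂ (δ₁ ⟨s (i₀ + n) ^ 2, hs⟩))) :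
    -- `hns` VERBATIM (res-D-pv-012 `exists_lowTower`)
    (∀ n (hle : R (i₀ + n) ≤ Λ) (hs : s (i₀ + n) ^ 2 ∈ R (i₀ + n)) (Q : Ideal (R (i₀ + n))) [Q.IsPrime],
      (∀ r : R (i₀ + n), r ∈ Q ↔ ¬ IsUnit (⟨(r : K), hle r.2⟩ : Λ)) →
      IsRegularLocalRing (AdjoinRoot ((X : (Localization.AtPrime Q)[X]) ^ 2 -
        C (algebraMap (R (i₀ + n)) (Localization.AtPrime Q) ⟨s (i₀ + n) ^ 2, hs⟩)))) ∧
    -- `hT9` at point stages (`IsPointStep` UNFOLDED), VERBATIM otherwise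
    (∀ n, (∃ hl : IsLocalRing (R (i₀ + n)), P (i₀ + n) = @maximalIdeal _ _ hl) →
      ∀ (hle : R (i₀ + n) ≤ Λ) (hs : s (i₀ + n) ^ 2 ∈ R (i₀ + n))
      (S : Type) [CommRing S] [IsLocalRing S] (ρ : R (i₀ + n) →+* S), Function.Surjective ρ →
      (∀ r : R (i₀ + n), ρ r = 0 ↔ ¬ IsUnit (⟨(r : K), hle r.2⟩ : Λ)) →
      ∀ (Q : Ideal S) [Q.IsPrime], Q ≠ ⊥ → Q ≠ maximalIdeal S → IsRegularLocalRing (S ⧸ Q) →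
      IsRegularLocalRing (AdjoinRoot ((X : (Localization.AtPrime Q)[X]) ^ 2 -
        C (algebraMap S (Localization.AtPrime Q) (ρ ⟨s (i₀ + n) ^ 2, hs⟩))))) := by
  classical
  haveI : Fact (2 : ℕ).Prime := ⟨Nat.prime_two⟩
  -- `hns` at every stage
  have hns : ∀ n (hle : R (i₀ + n) ≤ Λ) (hs : s (i₀ + n) ^ 2 ∈ R (i₀ + n)) (Q : Ideal (R (i₀ + n))) [Q.IsPrime],
      (∀ r : R (i₀ + n), r ∈ Q ↔ ¬ IsUnit (⟨(r : K), hle r.2⟩ : Λ)) →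
      IsRegularLocalRing (AdjoinRoot ((X : (Localization.AtPrime Q)[X]) ^ 2 -
        C (algebraMap (R (i₀ + n)) (Localization.AtPrime Q) ⟨s (i₀ + n) ^ 2, hs⟩))) := by
    intro n hle hs Q _ hQ
    haveI := hreg n
    haveI : IsLocalRing (R (i₀ + n + 1)) := (hreg (n + 1)).toIsLocalRing
    obtain ⟨hle', _, hs₁, δ₁, δ₂, h1, h2, h3⟩ := hinv n
    obtain ⟨x, G, ⟨hxR, hxP⟩, hx0, hxmax, hG, hstep⟩ := hx n
    have hxu := isUnit_excParam_of_step (hRO n) hle' (hs2 n) (hs2 (n + 1)) δ₁ δ₂ h1 h2 h3 (hσ n inferInstance)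
      (hbl n) hxR hxP hx0 hxmax hG hstep (hsing (n + 1))
    exact isRegularLocalRing_torsor_at_trace hle' _ δ₁ δ₂ h1 h2 (hσ n inferInstance) hxR hxP hxu Q
      hQ
  refine ⟨hns, fun n hpt hle hs S _ _ ρ hρ hker Q _ hQ0 hQm hQreg => ?_⟩
  haveI := hreg n
  obtain ⟨hle', _, hs₁, δ₁, δ₂, h1, h2, h3⟩ := hinv n
  obtain ⟨hl, hPt⟩ := hpt
  have hpoint : ∀ Q' : Ideal (R (i₀ + n)), ¬ IsPermissibleCentre (R (i₀ + n)) 2 ⟨s (i₀ + n) ^ 2, hs2 n⟩ Q' := by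
    rcases hσ n inferInstance with hperm | ⟨-, hnone, -⟩
    · exact absurd hPt hperm.1
    · exact hnone
  exact isRegularLocalRing_torsor_image_of_pointStep hle' (hdim n) _ δ₁ δ₂ h1 h2 h3 hpoint
    (fun Q' _ hQ' => hns n hle' (hs2 n) Q' hQ') S ρ hρ hker Q hQ0 hQm hQreg

end Summit.ResolutionOfSingularities.ResolutionOfSingularities.Theorems.SwitchingDichotomy.LowTowerInputs

end
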